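import Literature.Combinatorics.Additive.GlobalProductMixing
import HarnessLib

/-!
# The level-`d` inequality for global sets in the symmetric group (Keevash–Lifshitz 2023, Theorem 1.8)

Source: P. Keevash, N. Lifshitz, *Sharp hypercontractivity for symmetric groups and its applications*,
arXiv:2307.15030 (bib key `KeevashLifshitz2023`), §1.2 "Globalness and Analysis in symmetric groups",
pp. 4–5 (held text `paper:arxiv-2307.15030`, p0004–p0005 read first-hand).
PUBLICATION STATUS (recorded 2026-08-27): the source is an arXiv PREPRINT (2023); Theorem 1.8 is restated
verbatim (with `r > 1` explicit) and used as a black box in the PUBLISHED paper N. Keller, N. Lifshitz,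
O. Sheinfeld, *Improved covering results for conjugacy classes of symmetric groups via hypercontractivity*,
Forum Math. Sigma 12 (2024) e85, Theorem 4.1 (bib key `KellerLifshitzSheinfeld2024`; held text
`paper:arxiv-2310.18107`, p0010 read first-hand) — cited below as the secondary source; the proof's
product-space engine (the sharp level-`d` inequality for global functions on product spaces) is published as
Keller–Lifshitz–Marcus, J. Eur. Math. Soc. (2023), doi:10.4171/jems/1762. The earlier PUBLISHED level-`d`
inequality on `S_n`, Filmus–Kindler–Lifshitz–Minzer, Forum Math. Sigma 12 (2024), Thm. 1.7 (constants
`2^{C d⁴}`, hypothesis `n ≥ 2^{C d³} log(1/‖f‖₂²)^{C d}`), is NOT a substitute for the consumer below, which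
needs `d` up to `≍ n^{1/4}/log n` at densities `e^{−Θ(n^{1/4})}` (cell pnp-psdrank, LIT-17 §2).
This module adds to the
tree's Keevash–Lifshitz vocabulary (`umvirate`, `IsGlobal` = Def. 1.6, in
`Literature/Combinatorics/Additive/GlobalProductMixing.lean`, whose docstring lists "the degree
decomposition `V_{=d}`, Thm. 1.8" as deliberately not typed there) exactly that:

* `SnSpace n` — `L²(S_n)` realised as `EuclideanSpace ℝ (Equiv.Perm (Fin n))`; the paper's inner
  product `⟨f, g⟩ = 𝔼_σ f(σ)g(σ)` (p. 4) is the Euclidean one divided by `n!`, so every squared norm of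
  the paper is a squared Euclidean norm divided by `n!` (orthogonal projections do not depend on this
  scaling);
* `degLE n d` — **Def. 1.7**, `V_{≤ d}`: "all functions `f(σ) = g((x_{i→j}(σ))_{i,j})` where `g` is a
  multivariate degree `d` polynomial in the `n²` variables `x_{ij}`" with the dictators
  `x_{i→j} = 1_{U_{i→j}}`. A monomial of degree `t ≤ d` in the dictators is the indicator of the
  intersection of `t` one-point umvirates, i.e. of a `t`-umvirate `U_{I→J}` with ARBITRARY (possibly
  non-injective) `I, J : Fin t → Fin n` — empty, hence `0`, for inconsistent data —, so `V_{≤ d}` is the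
  linear span of the indicator vectors of the `t`-umvirates with `t ≤ d` (the `t = 0` umvirate is all of
  `S_n`, the constants). This is the form typed here;
* `projLE n d` — `f ↦ f^{≤ d}`, "the orthogonal projection of `f` on `V_{≤ d}`" (Mathlib's
  `Submodule.starProjection`); `levelPart n d f` — "the degree `d` part `f^{=d} := f^{≤ d} − f^{≤ d−1}`"
  (with `f^{=0} = f^{≤ 0}`);
* `GlobalLevelDInequality` — **Theorem 1.8** as a NAMED FACT (`def … : Prop`, not proved here: the
  proof is the paper's sharp hypercontractive inequality for global functions, Thm. 1.10/4.1, via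
  representation theory of `S_n` — far outside Mathlib): "For some absolute constant `C > 0`, if
  `A ⊆ S_n` is `r`-global and `d ≤ min(⅛ log(1/μ(A)), 10⁻⁵ n)` then
  `‖1_A^{=d}‖₂² ≤ μ(A)² (C r⁴ d⁻¹ log(1/μ(A)))^d`." Transcribed verbatim with `μ(A) = |A|/n!`,
  `‖·‖₂² = ‖·‖²_{Eucl}/n!`, `log = Real.log` (if the paper's `log` were binary the hypothesis
  `d ≤ ⅛ log(1/μ)` would only become MORE permissive, so this reading asks no more than print) and
  `d⁻¹ = 1/d` (at `d = 0` both sides equal `μ(A)²`, see `levelPart_zero_indVec`);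
* PROVED, for consumers: the variational ("dual") reading of a level-`d` bound —
  `inner_eq_inner_levelPart` (for `g ∈ V_{≤ d}` orthogonal to `V_{≤ d−1}`, `⟨f, g⟩ = ⟨f^{=d}, g⟩`),
  `sq_inner_le_norm_levelPart_sq_mul` (`⟨f, g⟩² ≤ ‖f^{=d}‖² ‖g‖²`) and `GlobalLevelDInequality.dual`
  (`(Σ_{σ ∈ A} g σ)² ≤ ‖g‖² · n! · μ(A)² (C r⁴ d⁻¹ log(1/μ(A)))^d` for such `g`), which is how a
  level-`d` inequality is used against an explicit degree-`d` test function.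

Consumer (cell pnp-psdrank, rung F-N2, route `ChebyshevTracialDesign`, crux stmt-PneNP-19878): the
input «(F2)» of the `r = 1` rung's step S4 (p1 N2-SpreadStructure §SNT; R1-SKELETON S4) — the
matching-side level-`k` inequality — is this theorem pulled back along `S_n → PM_n`,
`σ ↦ {σ(2i−1)σ(2i)}_i` (a separate module proves the pull-back; nothing here refers to matchings).
WHAT THIS IS NOT: not a proof of Theorem 1.8; nothing about psd rank; no P-vs-NP content.
-/

noncomputable section

namespace Literature.Combinatorics.Additive.KeevashLifshitz

open Finset
open scoped InnerProductSpace

/-- `L²(S_n)` as a Euclidean space: real functions on `Equiv.Perm (Fin n)` with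
`⟪f, g⟫ = Σ_σ f σ · g σ` (the paper's `𝔼_σ f g` is this divided by `n!`).
[cite: KeevashLifshitz2023, §1.2 (p. 4, "the space `L²(S_n, μ)`")] -/
abbrev SnSpace (n : ℕ) : Type := EuclideanSpace ℝ (Equiv.Perm (Fin n))

variable {n d : ℕ}

/-- A real function on `S_n` as a vector of `SnSpace n`. [cite: KeevashLifshitz2023, §1.2 (p. 4)] -/
def vec (f : Equiv.Perm (Fin n) → ℝ) : SnSpace n := WithLp.toLp 2 f

/-- [cite: KeevashLifshitz2023, §1.2 (p. 4)] -/
@[simp] theorem vec_apply (f : Equiv.Perm (Fin n) → ℝ) (σ : Equiv.Perm (Fin n)) : vec f σ = f σ := rfl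

/-- The indicator vector `1_A` of a set of permutations. [cite: KeevashLifshitz2023, Def. 1.6 ("its indicator function `1_A`")] -/
def indVec (A : Finset (Equiv.Perm (Fin n))) : SnSpace n := vec fun σ => if σ ∈ A then 1 else 0

/-- [cite: KeevashLifshitz2023, Def. 1.6] -/
@[simp] theorem indVec_apply (A : Finset (Equiv.Perm (Fin n))) (σ : Equiv.Perm (Fin n)) :
    indVec A σ = if σ ∈ A then 1 else 0 := rfl

/-- The Euclidean inner product on `SnSpace n` is the plain sum `Σ_σ x σ · y σ`.
[cite: KeevashLifshitz2023, §1.2 (p. 4, the inner product `⟨f, g⟩ = 𝔼_σ f(σ)g(σ)`, here un-normalised)] -/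
theorem inner_eq_sum (x y : SnSpace n) : ⟪x, y⟫_ℝ = ∑ σ, x σ * y σ := by
  rw [PiLp.inner_apply]
  exact sum_congr rfl fun σ _ => by simp [mul_comm]

/-- `‖x‖² = Σ_σ (x σ)²`. [cite: KeevashLifshitz2023, §1.2 (p. 4)] -/
theorem norm_sq_eq_sum (x : SnSpace n) : ‖x‖ ^ 2 = ∑ σ, x σ ^ 2 := by
  rw [EuclideanSpace.norm_eq, Real.sq_sqrt (by positivity)]
  exact sum_congr rfl fun σ _ => by simp [sq_abs]

/-- `⟪1_A, g⟫ = Σ_{σ ∈ A} g σ`. [cite: KeevashLifshitz2023, Def. 1.6] -/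
theorem inner_indVec_left (A : Finset (Equiv.Perm (Fin n))) (g : SnSpace n) :
    ⟪indVec A, g⟫_ℝ = ∑ σ ∈ A, g σ := by
  rw [inner_eq_sum]
  simp only [indVec_apply, ite_mul, one_mul, zero_mul]
  rw [sum_ite_mem, univ_inter]

/-- `‖1_A‖² = |A|` (so the paper's `‖1_A‖₂² = μ(A) = |A|/n!`). [cite: KeevashLifshitz2023, Def. 1.6] -/
theorem norm_indVec_sq (A : Finset (Equiv.Perm (Fin n))) : ‖indVec A‖ ^ 2 = (A.card : ℝ) := by
  rw [norm_sq_eq_sum]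
  simp only [indVec_apply]
  rw [show (∑ σ : Equiv.Perm (Fin n), (if σ ∈ A then (1 : ℝ) else 0) ^ 2) =
      ∑ σ : Equiv.Perm (Fin n), (if σ ∈ A then (1 : ℝ) else 0) from
    sum_congr rfl fun σ _ => by split_ifs <;> simp]
  rw [sum_boole]
  simp

/-! ## Def. 1.7: the degree filtration `V_{≤ d}` and the degree-`d` parts `f^{=d}` -/

/-- **`V_{≤ d}`** (Keevash–Lifshitz **Def. 1.7**, following Ellis–Friedgut–Pilpel): the functions on `S_n`
expressible as a polynomial of degree `≤ d` in the dictators `x_{i→j} = 1_{U_{i→j}}`; equivalently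
(a degree-`t` monomial in dictators being the indicator of a `t`-umvirate with arbitrary index data)
the linear span of the indicator vectors `1_{U_{I→J}}`, `I J : Fin t → Fin n`, `t ≤ d`.
[cite: KeevashLifshitz2023, Def. 1.7] -/
def degLE (n d : ℕ) : Submodule ℝ (SnSpace n) :=
  Submodule.span ℝ {v : SnSpace n | ∃ t : ℕ, t ≤ d ∧ ∃ I J : Fin t → Fin n, v = indVec (umvirate I J)}

/-- Umvirate indicators of size `t ≤ d` lie in `V_{≤ d}`. [cite: KeevashLifshitz2023, Def. 1.7] -/
theorem indVec_umvirate_mem_degLE {t d : ℕ} (ht : t ≤ d) (I J : Fin t → Fin n) :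
    indVec (umvirate I J) ∈ degLE n d :=
  Submodule.subset_span ⟨t, ht, I, J, rfl⟩

/-- The filtration is increasing: `V_{≤ d} ≤ V_{≤ d'}` for `d ≤ d'`. [cite: KeevashLifshitz2023, Def. 1.7] -/
theorem degLE_mono {d d' : ℕ} (h : d ≤ d') : degLE n d ≤ degLE n d' := by
  apply Submodule.span_mono
  rintro v ⟨t, ht, I, J, rfl⟩
  exact ⟨t, ht.trans h, I, J, rfl⟩

/-- The `0`-umvirate is all of `S_n`. [cite: KeevashLifshitz2023, §1.2 (p. 4)] -/
theorem umvirate_fin_zero (I J : Fin 0 → Fin n) : umvirate I J = univ := by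
  ext σ
  simp [mem_umvirate]

/-- The constants lie in every `V_{≤ d}`: `1_{S_n} ∈ V_{≤ d}`. [cite: KeevashLifshitz2023, Def. 1.7] -/
theorem indVec_univ_mem_degLE (d : ℕ) : indVec (univ : Finset (Equiv.Perm (Fin n))) ∈ degLE n d := by
  have h := indVec_umvirate_mem_degLE (n := n) (Nat.zero_le d) Fin.elim0 Fin.elim0
  rwa [umvirate_fin_zero] at h

/-- **`f ↦ f^{≤ d}`**, the orthogonal projection onto `V_{≤ d}`. [cite: KeevashLifshitz2023, Def. 1.7] -/
def projLE (n d : ℕ) : SnSpace n →L[ℝ] SnSpace n := (degLE n d).starProjection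

/-- `f^{≤ d} ∈ V_{≤ d}`. [cite: KeevashLifshitz2023, Def. 1.7] -/
theorem projLE_mem (d : ℕ) (f : SnSpace n) : projLE n d f ∈ degLE n d :=
  (degLE n d).starProjection_apply_mem f

/-- `f − f^{≤ d} ⊥ V_{≤ d}`. [cite: KeevashLifshitz2023, Def. 1.7] -/
theorem inner_sub_projLE_eq_zero (d : ℕ) (f : SnSpace n) {w : SnSpace n} (hw : w ∈ degLE n d) :
    ⟪f - projLE n d f, w⟫_ℝ = 0 :=
  (degLE n d).starProjection_inner_eq_zero f w hw

/-- **The degree-`d` part** `f^{=d} := f^{≤ d} − f^{≤ d−1}` (and `f^{=0} := f^{≤ 0}`, the paper's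
`V_{≤ −1} = 0`). [cite: KeevashLifshitz2023, Def. 1.7] -/
def levelPart (n d : ℕ) (f : SnSpace n) : SnSpace n :=
  if d = 0 then projLE n 0 f else projLE n d f - projLE n (d - 1) f

/-- `f^{=d} ∈ V_{≤ d}`. [cite: KeevashLifshitz2023, Def. 1.7] -/
theorem levelPart_mem (d : ℕ) (f : SnSpace n) : levelPart n d f ∈ degLE n d := by
  unfold levelPart
  split_ifs with hd
  · subst hd; exact projLE_mem 0 f
  · exact Submodule.sub_mem _ (projLE_mem d f) (degLE_mono (Nat.sub_le d 1) (projLE_mem (d - 1) f))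

/-- `f^{=d} ⊥ V_{≤ d−1}` (for `d ≥ 1`). [cite: KeevashLifshitz2023, Def. 1.7] -/
theorem inner_levelPart_eq_zero (hd : 1 ≤ d) (f : SnSpace n) {w : SnSpace n} (hw : w ∈ degLE n (d - 1)) :
    ⟪levelPart n d f, w⟫_ℝ = 0 := by
  unfold levelPart
  rw [if_neg (by omega)]
  -- `⟪P_d f − P_{d−1} f, w⟫ = ⟪(f − P_{d−1} f) − (f − P_d f), w⟫ = 0 − 0`
  have h1 := inner_sub_projLE_eq_zero (d - 1) f hw
  have h2 := inner_sub_projLE_eq_zero d f (degLE_mono (Nat.sub_le d 1) hw)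
  have : projLE n d f - projLE n (d - 1) f = (f - projLE n (d - 1) f) - (f - projLE n d f) := by abel
  rw [this, inner_sub_left, h1, h2, sub_zero]

/-- **Variational reading of the degree-`d` part.** If `g ∈ V_{≤ d}` is orthogonal to `V_{≤ d−1}`
(a "pure degree `d`" test function) then `⟨f, g⟩ = ⟨f^{=d}, g⟩`. [cite: KeevashLifshitz2023, Def. 1.7] -/
theorem inner_eq_inner_levelPart (hd : 1 ≤ d) (f : SnSpace n) {g : SnSpace n} (hg : g ∈ degLE n d)
    (hg' : ∀ w ∈ degLE n (d - 1), ⟪g, w⟫_ℝ = 0) : ⟪f, g⟫_ℝ = ⟪levelPart n d f, g⟫_ℝ := by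
  unfold levelPart
  rw [if_neg (by omega), inner_sub_left]
  have h1 : ⟪f, g⟫_ℝ = ⟪projLE n d f, g⟫_ℝ := by
    have := inner_sub_projLE_eq_zero d f hg
    rwa [inner_sub_left, sub_eq_zero] at this
  have h2 : ⟪projLE n (d - 1) f, g⟫_ℝ = 0 := by
    rw [real_inner_comm]; exact hg' _ (projLE_mem (d - 1) f)
  rw [h1, h2, sub_zero]

/-- The same at `d = 0`: for `g ∈ V_{≤ 0}`, `⟨f, g⟩ = ⟨f^{=0}, g⟩`. [cite: KeevashLifshitz2023, Def. 1.7] -/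
theorem inner_eq_inner_levelPart_zero (f : SnSpace n) {g : SnSpace n} (hg : g ∈ degLE n 0) :
    ⟪f, g⟫_ℝ = ⟪levelPart n 0 f, g⟫_ℝ := by
  unfold levelPart
  rw [if_pos rfl]
  have := inner_sub_projLE_eq_zero 0 f hg
  rwa [inner_sub_left, sub_eq_zero] at this

/-- **Cauchy–Schwarz against a pure degree-`d` test function**: `⟨f, g⟩² ≤ ‖f^{=d}‖² · ‖g‖²` for
`g ∈ V_{≤ d}` orthogonal to `V_{≤ d−1}`, `d ≥ 1` — the way a level-`d` inequality is consumed.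
[cite: KeevashLifshitz2023, §1.2 (p. 5, "the low degrees have low Fourier weight")] -/
theorem sq_inner_le_norm_levelPart_sq_mul (hd : 1 ≤ d) (f : SnSpace n) {g : SnSpace n}
    (hg : g ∈ degLE n d) (hg' : ∀ w ∈ degLE n (d - 1), ⟪g, w⟫_ℝ = 0) :
    ⟪f, g⟫_ℝ ^ 2 ≤ ‖levelPart n d f‖ ^ 2 * ‖g‖ ^ 2 := by
  rw [inner_eq_inner_levelPart hd f hg hg', ← mul_pow]
  have h := abs_real_inner_le_norm (levelPart n d f) g
  calc ⟪levelPart n d f, g⟫_ℝ ^ 2 = |⟪levelPart n d f, g⟫_ℝ| ^ 2 := (sq_abs _).symm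
    _ ≤ (‖levelPart n d f‖ * ‖g‖) ^ 2 := by gcongr

/-- Sanity / the `d = 0` case: `1_A^{=0} = μ(A) · 1_{S_n}` (the projection of `1_A` on the constants),
so `‖1_A^{=0}‖²/n! = μ(A)²` and Theorem 1.8 holds with equality at `d = 0`.
[cite: KeevashLifshitz2023, Def. 1.7] -/
theorem levelPart_zero_indVec (A : Finset (Equiv.Perm (Fin n))) :
    levelPart n 0 (indVec A) = ((A.card : ℝ) / n.factorial) • indVec (univ : Finset (Equiv.Perm (Fin n))) := by
  -- the candidate lies in `V_{≤ 0}` and the difference is orthogonal to `V_{≤ 0}`, which is spanned by `1_{S_n}`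
  have hV : degLE n 0 = Submodule.span ℝ {indVec (univ : Finset (Equiv.Perm (Fin n)))} := by
    apply le_antisymm
    · apply Submodule.span_le.2
      rintro v ⟨t, ht, I, J, rfl⟩
      obtain rfl : t = 0 := by omega
      rw [umvirate_fin_zero]
      exact Submodule.subset_span rfl
    · exact Submodule.span_le.2 (by rintro v rfl; exact indVec_univ_mem_degLE 0)
  unfold levelPart
  rw [if_pos rfl]
  show (degLE n 0).starProjection (indVec A) = _
  apply (degLE n 0).eq_starProjection_of_mem_of_inner_eq_zero
  · exact Submodule.smul_mem _ _ (indVec_univ_mem_degLE 0)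
  · intro w hw
    rw [hV, Submodule.mem_span_singleton] at hw
    obtain ⟨a, rfl⟩ := hw
    rw [inner_smul_right, inner_sub_left, inner_smul_left, inner_indVec_left, inner_indVec_left]
    simp only [indVec_apply, mem_univ, if_true, sum_const, card_univ, Fintype.card_perm, Fintype.card_fin,
      nsmul_eq_mul, mul_one, RCLike.conj_to_real]
    have hf : (n.factorial : ℝ) ≠ 0 := by positivity
    field_simp
    ring

/-! ## Theorem 1.8 (named fact) and its consumer form -/

/-- **Level-`d` inequality for global sets in `S_n`** — Keevash–Lifshitz, arXiv:2307.15030,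
**Theorem 1.8**: "For some absolute constant `C > 0`, if `A ⊆ S_n` is `r`-global and
`d ≤ min(⅛ log(1/μ(A)), 10⁻⁵ n)` then `‖1_A^{=d}‖₂² ≤ μ(A)² (C r⁴ d⁻¹ log(1/μ(A)))^d`."
Here `μ(A) = |A|/n!`, `‖1_A^{=d}‖₂² = ‖levelPart n d (indVec A)‖²/n!` (expectation norm),
`IsGlobal r A` is Def. 1.6 (tree), `log = Real.log`, `d⁻¹ = 1/d`. NAMED FACT, not proved in the tree: the
proof is the paper's sharp hypercontractivity for global functions (Thms. 1.10, 4.1) and §5–§6.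
Sharpness: the paper's Example `ex:leveld`; comparison with Filmus–Kindler–Lifshitz–Minzer 2020 on p. 5.
Source status: arXiv preprint; restated verbatim (for `r > 1`) as Theorem 4.1 of the published
Keller–Lifshitz–Sheinfeld 2024 (secondary source, statement only).
[cite: KeevashLifshitz2023, Thm. 1.8] [cite: KellerLifshitzSheinfeld2024, Thm. 4.1 (p. 10; restatement)] -/
def GlobalLevelDInequality : Prop :=
  ∃ C : ℝ, 0 < C ∧ ∀ (n : ℕ) (A : Finset (Equiv.Perm (Fin n))) (r : ℝ) (d : ℕ),
    IsGlobal r A →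
    (d : ℝ) ≤ Real.log (1 / ((A.card : ℝ) / n.factorial)) / 8 →
    (d : ℝ) ≤ (n : ℝ) / 10 ^ 5 →
    ‖levelPart n d (indVec A)‖ ^ 2 / n.factorial ≤
      ((A.card : ℝ) / n.factorial) ^ 2 *
        (C * r ^ 4 * (1 / (d : ℝ)) * Real.log (1 / ((A.card : ℝ) / n.factorial))) ^ d

/-- **Consumer form of Theorem 1.8** (the fact `GlobalLevelDInequality` read against a test function):
for `r`-global `A ⊆ S_n`, `1 ≤ d ≤ min(⅛ log(1/μ(A)), 10⁻⁵ n)` and every `g ∈ V_{≤ d}` orthogonal to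
`V_{≤ d−1}`, `(Σ_{σ ∈ A} g σ)² ≤ ‖g‖² · n! · μ(A)² · (C r⁴ d⁻¹ log(1/μ(A)))^d` (`μ(A) = |A|/n!`,
`‖g‖² = Σ_σ (g σ)²`). [cite: KeevashLifshitz2023, Thm. 1.8] -/
theorem GlobalLevelDInequality.dual (h : GlobalLevelDInequality) :
    ∃ C : ℝ, 0 < C ∧ ∀ (n : ℕ) (A : Finset (Equiv.Perm (Fin n))) (r : ℝ) (d : ℕ) (g : SnSpace n),
      1 ≤ d → IsGlobal r A →
      (d : ℝ) ≤ Real.log (1 / ((A.card : ℝ) / n.factorial)) / 8 →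
      (d : ℝ) ≤ (n : ℝ) / 10 ^ 5 →
      g ∈ degLE n d → (∀ w ∈ degLE n (d - 1), ⟪g, w⟫_ℝ = 0) →
      (∑ σ ∈ A, g σ) ^ 2 ≤
        ‖g‖ ^ 2 * n.factorial * (((A.card : ℝ) / n.factorial) ^ 2 *
          (C * r ^ 4 * (1 / (d : ℝ)) * Real.log (1 / ((A.card : ℝ) / n.factorial))) ^ d) := by
  obtain ⟨C, hC, hmain⟩ := h
  refine ⟨C, hC, fun n A r d g hd hA h8 hn hg hg' => ?_⟩
  have hlev := hmain n A r d hA h8 hn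
  have hcs := sq_inner_le_norm_levelPart_sq_mul hd (indVec A) hg hg'
  rw [inner_indVec_left] at hcs
  have hfac : (0 : ℝ) < n.factorial := by exact_mod_cast n.factorial_pos
  rw [div_le_iff₀ hfac] at hlev
  calc (∑ σ ∈ A, g σ) ^ 2 ≤ ‖levelPart n d (indVec A)‖ ^ 2 * ‖g‖ ^ 2 := hcs
    _ ≤ (((A.card : ℝ) / n.factorial) ^ 2 *
          (C * r ^ 4 * (1 / (d : ℝ)) * Real.log (1 / ((A.card : ℝ) / n.factorial))) ^ d * n.factorial) * ‖g‖ ^ 2 := by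
        gcongr
    _ = _ := by ring

end Literature.Combinatorics.Additive.KeevashLifshitz
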